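import Summits.BirchSwinnertonDyer.BirchSwinnertonDyer.Theorems.PrintCFramBottomClassIndexLawFiveLeHerbrandSelmerToHomField
import Literature.NumberTheory.GaloisRepresentations.AbsGaloisOuterConj
import Literature.NumberTheory.GaloisRepresentations.SorensenPatching

/-!
# Road C, stub D (Galois half): transport of LEAD g9's `ODD(r, N)` / `EVEN(r, N′)` from `Γ_ℚ`-currency to
# `Γ_L`-currency along `res : Γ_L → Γ_ℚ`

Summit `BirchSwinnertonDyer`, crux `PrintCFram.BottomClassIndexLawFiveLe` (stmt-BirchSwinnertonDyer-20372), line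
`eisenstein-resource-bdp-line`, Stub H′ `stub_homVanishing_of_bernoulliPair`; width seat `bsd-line-cfram-p1-w4` g5, typing item
«D-gal» of LEAD g9's ROAD C («the conjugation swap», STATUS 17:46Z/18:01Z 2026-08-28).  HONEST FRAMING: pure transport of
hypotheses between two currencies; no summit statement is proved here and no stub is closed.

LEAD g9's `Γ_ℚ`-currency shapes (verbatim, `N ≤ Γ_ℚ`, `r : Γ_ℚ →* (ZMod p)ˣ`):
`ODD(r, N)` := every `G : Γ_ℚ → ZMod p`, continuous and additive on `N`, with `G (g n g⁻¹) = r g · G n` for ALL `g ∈ Γ_ℚ`, killing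
`N ∩ I_𝔓` for EVERY prime `𝔓` of `\bar ℤ` (`𝔓 ∈ ℓ.primesAbove`, all `ℓ`), vanishes on `N`; `EVEN(r, N′)` := the same with only the
`ℓ ∌ p`.  Here `N = range (absGaloisRestrict ℚ L)` for a number field `L` Galois over `ℚ` (a `Type`; LEAD's `L = K''(θ)`, `L′ = L(μ_p)`),
and the file proves `ODD(r, range res_{ℚ,L}) ⟸ ODD_L(r)` and `EVEN(r, range res_{ℚ,L}) ⟸ EVEN_L(r)`, where the `Γ_L`-currency
statements are the ones the T5 consumers prove (w6 g0's stub O via the Hilbert class field, w8 g0's stub E via Kummer theory):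

* additive form: `κ : Γ_L → ZMod p` continuous, additive, `κ (absGaloisOuterConj ℚ L γ σ) = r γ · κ σ` (`γ ∈ Γ_ℚ`), killing
  `𝔔.inertia Γ_L` for `𝔔 ∈ u.primesAbove` (all places `u` of `L`, resp. the `u ∤ p`) ⟹ `κ = 0`;
* character form (w6's `HerbrandOddClassGroup.exists_factor_classGroup_of_unramified_of_odd` /
  `classGroupHom_mulEquiv_eq_pow_val` currency): `κ : Γ_L →* Multiplicative (ZMod p)` with OPEN kernel,
  `κ (absGaloisOuterConj ℚ L γ σ) = κ σ ^ (r γ).val`, `κ = 1` on every `𝔔.inertia Γ_L` (resp. for `u ∤ p`) ⟹ `κ = 1`.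

WHAT IS HERE: §1 `addChar_apply_one` / `isOpen_ker_of_continuous` / `pow_val_eq` (bookkeeping between the two forms),
**`forall_addChar_of_forall_character`**, **`forall_addChar_of_forall_character_offP`** (character form ⟹ additive form);
§2 **`oddVanishQ_of_forall_addChar_field`**, **`evenVanishQ_of_forall_addChar_field`** (the transports, additive form: pull `G` back
along `res`, `res (absGaloisOuterConj ℚ L γ σ) = γ · res σ · γ⁻¹`, and `τ ∈ I_𝔔 ↔ res τ ∈ I_{𝔔 ∩ \bar ℤ}` = p652039
`mem_inertia_iff_absGaloisRestrict_mem`, `𝔔 ∩ \bar ℤ ∈ (u ∩ ℚ).primesAbove` = tree `comap_absIntegersMap_mem_primesAbove`);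
§3 **`oddVanishQ_of_forall_character_field`**, **`evenVanishQ_of_forall_character_field`** (character form);
§4 the fields: **`exists_intermediateField_of_isOpen_of_normal`** (`N ≤ Γ_K` open normal ⟹ `E = K̄^N ⊆ K̄` finite Galois over `K` with
`E.fixingSubgroup = N` and `range (absGaloisRestrict K E) = N`), `isOpen_normal_ker_inf_range` (`N = ker r ⊓ range res_{ℚ,K}` is open
and normal for `K/ℚ` finite Galois and `ker r` open), `mem_ker_inf_range_iff` (LEAD's `hN : g ∈ N ↔ ∃ σ, θ σ = 1 ∧ res σ = g` for
`θ = r ∘ res`).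

References: J. Neukirch, *Algebraic Number Theory*, Ch. I §9, Ch. IV §1 [NeukirchANT1999]; B. Gross, LNM 776, §22;
the LEAD g9 STATUS lines of 2026-08-28 (Road C plan and the printed `ODD`/`EVEN` shapes).
-/

noncomputable section

-- summit-side namespace `Summit.BirchSwinnertonDyer.BirchSwinnertonDyer.…` (single-conjunct summit, D-0017 layout)
set_option linter.dupNamespace false
set_option autoImplicit false

open scoped Classical Pointwise
open NumberField IsDedekindDomain Field
open Literature.NumberTheory.GaloisRepresentations

namespace Summit.BirchSwinnertonDyer.BirchSwinnertonDyer.Theorems.PrintCFram.HerbrandSelmerToHom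

/-! ### §1 Bookkeeping between additive functions and characters into `Multiplicative (ZMod p)` -/

section Bookkeeping

variable {Γ : Type*} [Group Γ] [TopologicalSpace Γ] {p : ℕ}

omit [TopologicalSpace Γ] in
/-- An additive function on a group vanishes at `1`. [folklore] -/
theorem addChar_apply_one (κ : Γ → ZMod p) (hadd : ∀ a b, κ (a * b) = κ a + κ b) : κ 1 = 0 := by
  have h := hadd 1 1
  rw [mul_one] at h
  linear_combination -h

/-- A continuous function to the discrete `ZMod p` has open zero locus; as the kernel of the associated character.
[folklore] -/
theorem isOpen_ker_of_continuous (κ : Γ → ZMod p) (hκ : Continuous κ) (χ : Γ →* Multiplicative (ZMod p))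
    (hχ : ∀ g, χ g = Multiplicative.ofAdd (κ g)) : IsOpen (χ.ker : Set Γ) := by
  have e : (χ.ker : Set Γ) = κ ⁻¹' {0} := by
    ext g
    rw [SetLike.mem_coe, MonoidHom.mem_ker, hχ, Set.mem_preimage, Set.mem_singleton_iff, ofAdd_eq_one]
  rw [e]
  exact (isOpen_discrete _).preimage hκ

/-- `ofAdd (c · x) = (ofAdd x) ^ c.val` in `Multiplicative (ZMod p)`. [folklore] -/
theorem ofAdd_mul_eq_pow_val [NeZero p] (c x : ZMod p) :
    Multiplicative.ofAdd (c * x) = Multiplicative.ofAdd x ^ c.val := by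
  rw [← ofAdd_nsmul, nsmul_eq_mul, ZMod.natCast_zmod_val]

end Bookkeeping

/-! ### §2 The transports, additive form -/

section Transport

variable {p : ℕ} {L : Type} [Field L] [NumberField L] [IsGalois ℚ L]

omit [IsGalois ℚ L] in
/-- The pull-back `κ = G ∘ res` of a function continuous on `range res` is continuous. [folklore] -/
theorem continuous_comp_absGaloisRestrict {X : Type*} [TopologicalSpace X] (G : absoluteGaloisGroup ℚ → X)
    (hc : Continuous fun n : (absGaloisRestrict ℚ L).range => G n) :
    Continuous fun σ : absoluteGaloisGroup L => G (absGaloisRestrict ℚ L σ) :=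
  hc.comp ((absGaloisRestrict ℚ L).continuous.subtype_mk fun σ => ⟨σ, rfl⟩)

omit [IsGalois ℚ L] in
/-- `I_𝔔 ⊆ res⁻¹(I_{𝔔 ∩ \bar ℤ})` with `𝔔 ∩ \bar ℤ` above the place of `ℚ` under `u`: a function killing `N ∩ I_𝔓` for every
prime `𝔓` of `\bar ℤ` kills, after pull-back, every `I_𝔔 ≤ Γ_L`. [cite: NeukirchANT1999, Ch. I §9 (9.4)–(9.6)] -/
theorem comp_absGaloisRestrict_apply_eq_zero_of_mem_inertia (G : absoluteGaloisGroup ℚ → ZMod p)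
    (hI : ∀ (ℓ : HeightOneSpectrum (𝓞 ℚ)) (𝔓 : Ideal (absIntegers (𝓞 ℚ) ℚ)), 𝔓 ∈ ℓ.primesAbove →
      ∀ n ∈ (absGaloisRestrict ℚ L).range, n ∈ 𝔓.inertia (absoluteGaloisGroup ℚ) → G n = 0)
    {u : HeightOneSpectrum (𝓞 L)} {𝔔 : Ideal (absIntegers (𝓞 L) L)} (h𝔔 : 𝔔 ∈ u.primesAbove)
    {τ : absoluteGaloisGroup L} (hτ : τ ∈ 𝔔.inertia (absoluteGaloisGroup L)) :
    G (absGaloisRestrict ℚ L τ) = 0 :=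
  hI (u.under (𝓞 ℚ)) (𝔔.comap (absIntegersMap ℚ L)) (comap_absIntegersMap_mem_primesAbove (K := ℚ) (M := L) (v := u.under (𝓞 ℚ)) (w := u) rfl h𝔔) _ ⟨τ, rfl⟩
    ((mem_inertia_iff_absGaloisRestrict_mem 𝔔 τ).mp hτ)

omit [IsGalois ℚ L] in
/-- The place of `ℚ` under a place `u ∤ p` of `L` does not contain `p`. [folklore] -/
theorem natCast_not_mem_under {u : HeightOneSpectrum (𝓞 L)} (hu : ((p : ℕ) : 𝓞 L) ∉ u.asIdeal) :
    ((p : ℕ) : 𝓞 ℚ) ∉ (u.under (𝓞 ℚ)).asIdeal := by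
  intro h
  apply hu
  rw [HeightOneSpectrum.under_asIdeal, Ideal.under_def, Ideal.mem_comap, map_natCast] at h
  exact h

/-- **`ODD(r, range res_{ℚ,L}) ⟸ ODD_L(r)` (additive form).** [cite: NeukirchANT1999, Ch. IV §1; Ch. I §9] -/
theorem oddVanishQ_of_forall_addChar_field (r : absoluteGaloisGroup ℚ →* (ZMod p)ˣ)
    (hL : ∀ κ : absoluteGaloisGroup L → ZMod p, Continuous κ → (∀ a b, κ (a * b) = κ a + κ b) →
      (∀ (γ : absoluteGaloisGroup ℚ) (σ : absoluteGaloisGroup L),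
        κ (absGaloisOuterConj ℚ L γ σ) = ((r γ : (ZMod p)ˣ) : ZMod p) * κ σ) →
      (∀ (u : HeightOneSpectrum (𝓞 L)) (𝔔 : Ideal (absIntegers (𝓞 L) L)), 𝔔 ∈ u.primesAbove →
        ∀ τ ∈ 𝔔.inertia (absoluteGaloisGroup L), κ τ = 0) →
      ∀ σ, κ σ = 0) :
    ∀ G : absoluteGaloisGroup ℚ → ZMod p,
      (Continuous fun n : (absGaloisRestrict ℚ L).range => G n) →
      (∀ a ∈ (absGaloisRestrict ℚ L).range, ∀ b ∈ (absGaloisRestrict ℚ L).range, G (a * b) = G a + G b) →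
      (∀ (g : absoluteGaloisGroup ℚ), ∀ n ∈ (absGaloisRestrict ℚ L).range,
        G (g * n * g⁻¹) = ((r g : (ZMod p)ˣ) : ZMod p) * G n) →
      (∀ (ℓ : HeightOneSpectrum (𝓞 ℚ)) (𝔓 : Ideal (absIntegers (𝓞 ℚ) ℚ)), 𝔓 ∈ ℓ.primesAbove →
        ∀ n ∈ (absGaloisRestrict ℚ L).range, n ∈ 𝔓.inertia (absoluteGaloisGroup ℚ) → G n = 0) →
      ∀ n ∈ (absGaloisRestrict ℚ L).range, G n = 0 := by
  intro G hc hadd heq hI n hn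
  obtain ⟨σ₀, rfl⟩ := hn
  refine hL (fun σ => G (absGaloisRestrict ℚ L σ)) (continuous_comp_absGaloisRestrict G hc) (fun a b => ?_)
    (fun γ σ => ?_) (fun u 𝔔 h𝔔 τ hτ => comp_absGaloisRestrict_apply_eq_zero_of_mem_inertia G hI h𝔔 hτ) σ₀
  · simp only [map_mul]
    exact hadd _ ⟨a, rfl⟩ _ ⟨b, rfl⟩
  · simp only [absGaloisRestrict_absGaloisOuterConj]
    exact heq γ _ ⟨σ, rfl⟩

/-- **`EVEN(r, range res_{ℚ,L}) ⟸ EVEN_L(r)` (additive form; inertia conditions only at the places `∤ p`).**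
[cite: NeukirchANT1999, Ch. IV §1; Ch. I §9] -/
theorem evenVanishQ_of_forall_addChar_field (r : absoluteGaloisGroup ℚ →* (ZMod p)ˣ)
    (hL : ∀ κ : absoluteGaloisGroup L → ZMod p, Continuous κ → (∀ a b, κ (a * b) = κ a + κ b) →
      (∀ (γ : absoluteGaloisGroup ℚ) (σ : absoluteGaloisGroup L),
        κ (absGaloisOuterConj ℚ L γ σ) = ((r γ : (ZMod p)ˣ) : ZMod p) * κ σ) →
      (∀ (u : HeightOneSpectrum (𝓞 L)), ((p : ℕ) : 𝓞 L) ∉ u.asIdeal → ∀ 𝔔 ∈ u.primesAbove,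
        ∀ τ ∈ 𝔔.inertia (absoluteGaloisGroup L), κ τ = 0) →
      ∀ σ, κ σ = 0) :
    ∀ G : absoluteGaloisGroup ℚ → ZMod p,
      (Continuous fun n : (absGaloisRestrict ℚ L).range => G n) →
      (∀ a ∈ (absGaloisRestrict ℚ L).range, ∀ b ∈ (absGaloisRestrict ℚ L).range, G (a * b) = G a + G b) →
      (∀ (g : absoluteGaloisGroup ℚ), ∀ n ∈ (absGaloisRestrict ℚ L).range,
        G (g * n * g⁻¹) = ((r g : (ZMod p)ˣ) : ZMod p) * G n) →
      (∀ (ℓ : HeightOneSpectrum (𝓞 ℚ)), ((p : ℕ) : 𝓞 ℚ) ∉ ℓ.asIdeal → ∀ 𝔓 ∈ ℓ.primesAbove,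
        ∀ n ∈ (absGaloisRestrict ℚ L).range, n ∈ 𝔓.inertia (absoluteGaloisGroup ℚ) → G n = 0) →
      ∀ n ∈ (absGaloisRestrict ℚ L).range, G n = 0 := by
  intro G hc hadd heq hI n hn
  obtain ⟨σ₀, rfl⟩ := hn
  refine hL (fun σ => G (absGaloisRestrict ℚ L σ)) (continuous_comp_absGaloisRestrict G hc) (fun a b => ?_)
    (fun γ σ => ?_) (fun u hu 𝔔 h𝔔 τ hτ => ?_) σ₀
  · simp only [map_mul]
    exact hadd _ ⟨a, rfl⟩ _ ⟨b, rfl⟩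
  · simp only [absGaloisRestrict_absGaloisOuterConj]
    exact heq γ _ ⟨σ, rfl⟩
  · exact hI (u.under (𝓞 ℚ)) (natCast_not_mem_under hu) (𝔔.comap (absIntegersMap ℚ L))
      (comap_absIntegersMap_mem_primesAbove (K := ℚ) (M := L) (v := u.under (𝓞 ℚ)) (w := u) rfl h𝔔) _ ⟨τ, rfl⟩ ((mem_inertia_iff_absGaloisRestrict_mem 𝔔 τ).mp hτ)

/-! ### §3 The transports, character form -/

/-- Character form ⟹ additive form (all places). [folklore] -/
theorem forall_addChar_of_forall_character [NeZero p] (r : absoluteGaloisGroup ℚ →* (ZMod p)ˣ)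
    (hL : ∀ κ : absoluteGaloisGroup L →* Multiplicative (ZMod p), IsOpen (κ.ker : Set (absoluteGaloisGroup L)) →
      (∀ (γ : absoluteGaloisGroup ℚ) (σ : absoluteGaloisGroup L),
        κ (absGaloisOuterConj ℚ L γ σ) = κ σ ^ ((r γ : (ZMod p)ˣ) : ZMod p).val) →
      (∀ (u : HeightOneSpectrum (𝓞 L)) (𝔔 : Ideal (absIntegers (𝓞 L) L)), 𝔔 ∈ u.primesAbove →
        ∀ τ ∈ 𝔔.inertia (absoluteGaloisGroup L), κ τ = 1) →
      κ = 1) :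
    ∀ κ : absoluteGaloisGroup L → ZMod p, Continuous κ → (∀ a b, κ (a * b) = κ a + κ b) →
      (∀ (γ : absoluteGaloisGroup ℚ) (σ : absoluteGaloisGroup L),
        κ (absGaloisOuterConj ℚ L γ σ) = ((r γ : (ZMod p)ˣ) : ZMod p) * κ σ) →
      (∀ (u : HeightOneSpectrum (𝓞 L)) (𝔔 : Ideal (absIntegers (𝓞 L) L)), 𝔔 ∈ u.primesAbove →
        ∀ τ ∈ 𝔔.inertia (absoluteGaloisGroup L), κ τ = 0) →
      ∀ σ, κ σ = 0 := by
  intro κ hκ hadd heq hI σ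
  let χ : absoluteGaloisGroup L →* Multiplicative (ZMod p) :=
    { toFun := fun g => Multiplicative.ofAdd (κ g)
      map_one' := by rw [addChar_apply_one κ hadd, ofAdd_zero]
      map_mul' := fun a b => by rw [hadd, ofAdd_add] }
  have hχ : ∀ g, χ g = Multiplicative.ofAdd (κ g) := fun g => rfl
  have h1 : χ = 1 := by
    refine hL χ (isOpen_ker_of_continuous κ hκ χ hχ) (fun γ τ => ?_) (fun u 𝔔 h𝔔 τ hτ => ?_)
    · rw [hχ, hχ, heq, ofAdd_mul_eq_pow_val]
    · rw [hχ, hI u 𝔔 h𝔔 τ hτ, ofAdd_zero]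
  have h := hχ σ
  rw [h1, MonoidHom.one_apply, eq_comm, ofAdd_eq_one] at h
  exact h

/-- Character form ⟹ additive form (places `∤ p`). [folklore] -/
theorem forall_addChar_of_forall_character_offP [NeZero p] (r : absoluteGaloisGroup ℚ →* (ZMod p)ˣ)
    (hL : ∀ κ : absoluteGaloisGroup L →* Multiplicative (ZMod p), IsOpen (κ.ker : Set (absoluteGaloisGroup L)) →
      (∀ (γ : absoluteGaloisGroup ℚ) (σ : absoluteGaloisGroup L),
        κ (absGaloisOuterConj ℚ L γ σ) = κ σ ^ ((r γ : (ZMod p)ˣ) : ZMod p).val) →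
      (∀ (u : HeightOneSpectrum (𝓞 L)), ((p : ℕ) : 𝓞 L) ∉ u.asIdeal → ∀ 𝔔 ∈ u.primesAbove,
        ∀ τ ∈ 𝔔.inertia (absoluteGaloisGroup L), κ τ = 1) →
      κ = 1) :
    ∀ κ : absoluteGaloisGroup L → ZMod p, Continuous κ → (∀ a b, κ (a * b) = κ a + κ b) →
      (∀ (γ : absoluteGaloisGroup ℚ) (σ : absoluteGaloisGroup L),
        κ (absGaloisOuterConj ℚ L γ σ) = ((r γ : (ZMod p)ˣ) : ZMod p) * κ σ) →
      (∀ (u : HeightOneSpectrum (𝓞 L)), ((p : ℕ) : 𝓞 L) ∉ u.asIdeal → ∀ 𝔔 ∈ u.primesAbove,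
        ∀ τ ∈ 𝔔.inertia (absoluteGaloisGroup L), κ τ = 0) →
      ∀ σ, κ σ = 0 := by
  intro κ hκ hadd heq hI σ
  let χ : absoluteGaloisGroup L →* Multiplicative (ZMod p) :=
    { toFun := fun g => Multiplicative.ofAdd (κ g)
      map_one' := by rw [addChar_apply_one κ hadd, ofAdd_zero]
      map_mul' := fun a b => by rw [hadd, ofAdd_add] }
  have hχ : ∀ g, χ g = Multiplicative.ofAdd (κ g) := fun g => rfl
  have h1 : χ = 1 := by
    refine hL χ (isOpen_ker_of_continuous κ hκ χ hχ) (fun γ τ => ?_) (fun u hu 𝔔 h𝔔 τ hτ => ?_)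
    · rw [hχ, hχ, heq, ofAdd_mul_eq_pow_val]
    · rw [hχ, hI u hu 𝔔 h𝔔 τ hτ, ofAdd_zero]
  have h := hχ σ
  rw [h1, MonoidHom.one_apply, eq_comm, ofAdd_eq_one] at h
  exact h

/-- **`ODD(r, range res_{ℚ,L}) ⟸ ODD_L(r)` (character form, w6 g0's currency).** [cite: NeukirchANT1999, Ch. IV §1; Ch. I §9] -/
theorem oddVanishQ_of_forall_character_field [NeZero p] (r : absoluteGaloisGroup ℚ →* (ZMod p)ˣ)
    (hL : ∀ κ : absoluteGaloisGroup L →* Multiplicative (ZMod p), IsOpen (κ.ker : Set (absoluteGaloisGroup L)) →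
      (∀ (γ : absoluteGaloisGroup ℚ) (σ : absoluteGaloisGroup L),
        κ (absGaloisOuterConj ℚ L γ σ) = κ σ ^ ((r γ : (ZMod p)ˣ) : ZMod p).val) →
      (∀ (u : HeightOneSpectrum (𝓞 L)) (𝔔 : Ideal (absIntegers (𝓞 L) L)), 𝔔 ∈ u.primesAbove →
        ∀ τ ∈ 𝔔.inertia (absoluteGaloisGroup L), κ τ = 1) →
      κ = 1) :
    ∀ G : absoluteGaloisGroup ℚ → ZMod p,
      (Continuous fun n : (absGaloisRestrict ℚ L).range => G n) →
      (∀ a ∈ (absGaloisRestrict ℚ L).range, ∀ b ∈ (absGaloisRestrict ℚ L).range, G (a * b) = G a + G b) →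
      (∀ (g : absoluteGaloisGroup ℚ), ∀ n ∈ (absGaloisRestrict ℚ L).range,
        G (g * n * g⁻¹) = ((r g : (ZMod p)ˣ) : ZMod p) * G n) →
      (∀ (ℓ : HeightOneSpectrum (𝓞 ℚ)) (𝔓 : Ideal (absIntegers (𝓞 ℚ) ℚ)), 𝔓 ∈ ℓ.primesAbove →
        ∀ n ∈ (absGaloisRestrict ℚ L).range, n ∈ 𝔓.inertia (absoluteGaloisGroup ℚ) → G n = 0) →
      ∀ n ∈ (absGaloisRestrict ℚ L).range, G n = 0 :=
  oddVanishQ_of_forall_addChar_field r (forall_addChar_of_forall_character r hL)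

/-- **`EVEN(r, range res_{ℚ,L}) ⟸ EVEN_L(r)` (character form).** [cite: NeukirchANT1999, Ch. IV §1; Ch. I §9] -/
theorem evenVanishQ_of_forall_character_field [NeZero p] (r : absoluteGaloisGroup ℚ →* (ZMod p)ˣ)
    (hL : ∀ κ : absoluteGaloisGroup L →* Multiplicative (ZMod p), IsOpen (κ.ker : Set (absoluteGaloisGroup L)) →
      (∀ (γ : absoluteGaloisGroup ℚ) (σ : absoluteGaloisGroup L),
        κ (absGaloisOuterConj ℚ L γ σ) = κ σ ^ ((r γ : (ZMod p)ˣ) : ZMod p).val) →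
      (∀ (u : HeightOneSpectrum (𝓞 L)), ((p : ℕ) : 𝓞 L) ∉ u.asIdeal → ∀ 𝔔 ∈ u.primesAbove,
        ∀ τ ∈ 𝔔.inertia (absoluteGaloisGroup L), κ τ = 1) →
      κ = 1) :
    ∀ G : absoluteGaloisGroup ℚ → ZMod p,
      (Continuous fun n : (absGaloisRestrict ℚ L).range => G n) →
      (∀ a ∈ (absGaloisRestrict ℚ L).range, ∀ b ∈ (absGaloisRestrict ℚ L).range, G (a * b) = G a + G b) →
      (∀ (g : absoluteGaloisGroup ℚ), ∀ n ∈ (absGaloisRestrict ℚ L).range,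
        G (g * n * g⁻¹) = ((r g : (ZMod p)ˣ) : ZMod p) * G n) →
      (∀ (ℓ : HeightOneSpectrum (𝓞 ℚ)), ((p : ℕ) : 𝓞 ℚ) ∉ ℓ.asIdeal → ∀ 𝔓 ∈ ℓ.primesAbove,
        ∀ n ∈ (absGaloisRestrict ℚ L).range, n ∈ 𝔓.inertia (absoluteGaloisGroup ℚ) → G n = 0) →
      ∀ n ∈ (absGaloisRestrict ℚ L).range, G n = 0 :=
  evenVanishQ_of_forall_addChar_field r (forall_addChar_of_forall_character_offP r hL)

end Transport

/-! ### §4 The fields and the subgroups -/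

section Fields

variable {K : Type} [Field K] [CharZero K]

/-- **An open normal subgroup `N ≤ Γ_K` is `Gal(K̄/E) = range res_{K,E}` for the finite Galois extension `E = K̄^N ⊆ K̄`.**
[cite: NeukirchANT1999, Ch. IV §1] -/
theorem exists_intermediateField_of_isOpen_of_normal (N : Subgroup (absoluteGaloisGroup K)) [hn : N.Normal]
    (hN : IsOpen (N : Set (absoluteGaloisGroup K))) :
    ∃ E : IntermediateField K (AlgebraicClosure K), E.fixingSubgroup = N ∧ FiniteDimensional K E ∧ IsGalois K E ∧
      (absGaloisRestrict K E).range = N := by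
  haveI : IsGalois K (AlgebraicClosure K) := {}
  refine ⟨IntermediateField.fixedField N, fixingSubgroup_fixedField_of_isOpen N hN, finiteDimensional_fixedField N hN,
    IsGalois.of_fixedField_normal_subgroup (hn := hn) N, range_absGaloisRestrict_fixedField_eq_of_normal N hN⟩

variable {L : Type} [Field L] [Algebra K L] [FiniteDimensional K L] [IsGalois K L] [CharZero L]

omit [CharZero L] in
/-- **`N = ker r ⊓ range res_{K,L}` is open and normal** (`r` a character of `Γ_K` with open kernel, `L/K` finite Galois).
[folklore] -/
theorem isOpen_normal_ker_inf_range {A : Type*} [CommGroup A] (r : absoluteGaloisGroup K →* A)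
    (hr : IsOpen (r.ker : Set (absoluteGaloisGroup K))) :
    IsOpen ((r.ker ⊓ (absGaloisRestrict K L).range : Subgroup (absoluteGaloisGroup K)) : Set (absoluteGaloisGroup K)) ∧
      (r.ker ⊓ (absGaloisRestrict K L).range).Normal := by
  haveI : (absGaloisRestrict K L).range.Normal := normal_range_absGaloisRestrict K L
  refine ⟨?_, inferInstance⟩
  rw [Subgroup.coe_inf]
  exact hr.inter (isOpen_range_absGaloisRestrict K L)

omit [CharZero K] [FiniteDimensional K L] [IsGalois K L] [CharZero L] in
/-- LEAD g9's membership hypothesis `hN`: for `θ = r ∘ res_{K,L}`, `g ∈ ker r ⊓ range res ↔ ∃ σ, θ σ = 1 ∧ res σ = g`. [folklore] -/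
theorem mem_ker_inf_range_iff {A : Type*} [CommGroup A] (r : absoluteGaloisGroup K →* A) (g : absoluteGaloisGroup K) :
    g ∈ r.ker ⊓ (absGaloisRestrict K L).range ↔
      ∃ σ : absoluteGaloisGroup L, r (absGaloisRestrict K L σ) = 1 ∧ absGaloisRestrict K L σ = g := by
  constructor
  · rintro ⟨hk, σ, rfl⟩
    exact ⟨σ, hk, rfl⟩
  · rintro ⟨σ, hσ, rfl⟩
    exact ⟨hσ, σ, rfl⟩

end Fields

end Summit.BirchSwinnertonDyer.BirchSwinnertonDyer.Theorems.PrintCFram.HerbrandSelmerToHom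

end
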